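import Summits.QuantumFields.BalabanUV.Beta.GAN24.HardMinimiserOneStepSup
import Summits.QuantumFields.BalabanUV.T4Continuum.Support.CTScalarGreen
import Summits.QuantumFields.BalabanUV.T4Continuum.Support.ScalarCovariantCoercive
import Summits.QuantumFields.BalabanUV.T4Continuum.Support.CTAdmissibleRate
import Literature.MathematicalPhysics.QuantumFieldTheory.Balaban1983to89.Beta.EffectiveKernel

/-!
# G-an2-4 ∕ (CONV-C), road P2 — INTERFACE REQUEST (U-SINV), file 1 of 2: THE UNIT-LATTICE OPERATOR `S = Savg n M a′ = a′Q′G′Q′*`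
# HAS EXPONENTIALLY DECAYING ENTRIES, UNIFORMLY IN `n = η⁻¹` AND IN THE TORUS:
# `‖S(y,y′)‖ ≤ θ_S(d,a′)·e^{−κ_S(d,a′)·|y − y′|_T}`

G-an2-4 formalisation swarm, leaf seat `b2b-balaban-gan24-formalise-leaf-03` (gen 49), answering the road-P2 owner `b2b-balaban-gan24-p2`
(gen 29)'s «INTERFACE REQUEST G-an2-4: (U-SINV, for the HARD minimiser, MEDIUM)» (`HOME/INBOX.md` 2026-08-21T09:07Z): n-UNIFORM sup and
kernel bounds for `S_n⁻¹ = (a′Q′G′_nQ′*)⁻¹` (`HardMinimiserOneStepSup.Savg`), the binders `hS`, `hS′` of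
`HardMinimiserOneStepSup.norm_Mhard_succ_sub_stair_le_of_letters` and `MinimiserOneStepDecay.fieldDecay_Mhard_succ_sub_stair`.  The route
(ours) is Combes–Thomas ON THE UNIT TORUS for the Hermitian, uniformly coercive `S` (coercivity = the NE2 lane's
`ScalarAveragedCompressionSharp.form_Scomp_ge_sharp`, BY NAME, in file 2); its one analytic input beyond coercivity is the ENTRY DECAY of `S`,
proved HERE from the substrate's level-free weighted coercivity of `Δ′ = Δ + a′Π′` (`CTScalarGreen.wCoercive_DeltaPs`) read as an `ℓ²`
PAIRING bound between the two block rows `Q′(y,·)`, `Q′(y′,·)` — for block means the `ℓ²` bound loses nothing: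
`S(y,y′) = a′n^d·⟨Q′(y,·), G′ Q′(y′,·)ᴴ⟩`, `‖Q′(y,·)‖₂² = n^{−d}`.

 * §1 torus bookkeeping with NO `2 ≤ N_μ` proviso: `ldist_step_le_one`; the block set `blockSet n M y′` (a `Finset`), its chart;
   **`mul_ldist_le`**: `n·|y − y′|_{T₁} ≤ dist_{T_η}(x, t) + (n − 1)` for `x ∈ B(y)`, `t ∈ B(y′)` (`EffectiveKernel.circAbs_scale` per coordinate);
 * §2 the distance-to-the-block weight `ρ = ScalarCovariantCoercive.rhoS n M (blockSet y′)`: `1/n`-Lipschitz along fine bonds for EVERY torus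
   (`rhoS_lipschitz'`), `≤ 0` on `B(y′)`, `≥ |y − y′|_{T₁} − 1` on `B(y)`;
 * §3 `Savg_apply_eq_pairing` (`S(y,y′) = a′n^d·(Q′ y ⬝ᵥ G′ *ᵥ star (Q′ y′))`), `nsq_QsOp_row` (`= (n^d)⁻¹`);
 * §4 **`norm_Savg_apply_le_of_rate`**: for every `κ ≥ 0` with `Jfree d a′ κ 1 < γ′`:
   `‖S(y,y′)‖ ≤ a′e^{κ}/(γ′ − Jfree)·e^{−κ·|y − y′|_{T₁}}` (`CTWeightedCoercivity.WCoercive.pairing_decay_inv` BY NAME);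
 * §5 an admissible rate chosen once for all, `kappaS d a′ ∈ (0,1]` with `Jfree d a′ κ_S 1 ≤ γ′/2` (`CTAdmissibleRate`), `thetaS d a′ = 2a′e^{κ_S}/γ′`, and
   the END **`norm_Savg_apply_le`**: `‖Savg n M a′ y y′‖ ≤ thetaS d a′ · e^{−kappaS d a′ · ldist M y y′}` for EVERY `n ≥ 1` and EVERY torus `M`.

HONEST SCOPE.  [folklore] finite linear algebra + torus bookkeeping over the substrate's Combes–Thomas engine and the cell's typed `U = 1` scalar
objects; constants depend on `(d, a′)` only and are ours (crude: `γ′ = gammaPs d a′`); scalar `U = 1` prototype; an INPUT of road P2's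
hard-minimiser ENDs; discharges NOTHING of (CONV-C) as typed; NEVER «G-an2-4 closed»; NOT NE2, NOT D1, NOT BetaPertH, NOT continuum, NOT
Clay; no `def … : Prop`, no cited fact, 0 sorry — not in print, our proof.  HONEST DEPENDENCY: continuum YM on T⁴ ⇐ BetaPertH ∧ nine spine
estimates (0/9 proved); BetaPertH ⇐ (D1) ∧ (D4) ∧ CAP+tail; G-an2-4 gates asym, D1 and NE2/3/4.
-/

noncomputable section

open scoped BigOperators ComplexConjugate Matrix ComplexOrder Topology
open Finset

namespace Summit.QuantumFields.BalabanUV.Beta.GAN24.SavgEntryDecay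

open Literature.MathematicalPhysics.QuantumFieldTheory.Balaban1983to89
open B5Prop11Plancherel (Tor fine unitVec)
open B5Prop11Lower (nsq nsq_nonneg)
open B5Block118 (bpt QsOp)
open B5Blocks16 (blockOf blockOf_bpt bpt_bijective bpt_val sum_blocks)
open B4TorusKernel.MultiPeriod (circAbs circAbs_le_abs circAbs_nonneg)
open B4Sect5Torus (tdist ccoord ccoord_cast circAbs_le_tdist tdist_nonneg)
open Beta.TorusG0Decay (ldist toSite ldist_self ldist_symm ldist_triangle ldist_le_of_forall circAbs_val_add unitVec_same unitVec_ne)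
open Beta.EffectiveKernel (circAbs_scale)
open Beta.CombesThomasFormOp (distTo distTo_le le_distTo distTo_le_zero_of_mem abs_distTo_sub_le)
open Summit.QuantumFields.BalabanUV.T4Continuum
open Summit.QuantumFields.BalabanUV.T4Continuum.ScalarBlockPoincare (QsOp_apply_blockOf)
open Summit.QuantumFields.BalabanUV.T4Continuum.ScalarAveragedPropagator (DeltaPs Gps gammaPs gammaPs_pos)
open Summit.QuantumFields.BalabanUV.T4Continuum.ScalarCovariantCoercive (rhoS rhoS_osc)
open Summit.QuantumFields.BalabanUV.T4Continuum.CTScalarGreen (Jfree Jfree_nonneg Jfree_zero wCoercive_DeltaPs)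
open Summit.QuantumFields.BalabanUV.T4Continuum.CTWeightedCoercivity (WCoercive)
open Summit.QuantumFields.BalabanUV.T4Continuum.CTAdmissibleRate (continuous_Jfree exists_pos_le_one_of_eventually)
open Summit.QuantumFields.BalabanUV.Beta.GAN24.HardMinimiserOneStepSup (Savg Savg_eq)

variable {d : ℕ}

/-! ## §1 Torus bookkeeping: bonds, blocks, and the unit-vs-fine distance -/

section Torus

variable (N : Fin d → ℕ) [hN : ∀ μ, NeZero (N μ)]

/-- a bond has lattice length `≤ 1` — for EVERY period vector (no `2 ≤ N_μ` proviso: in a one-point direction the bond is a loop of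
length `0`). [folklore] -/
theorem ldist_step_le_one (x : Tor N) (μ : Fin d) : ldist N (x + unitVec N μ) x ≤ 1 := by
  have h : ldist N (x + unitVec N μ) x ≤ (1 : ℕ) := by
    refine ldist_le_of_forall N fun i => ?_
    rw [Pi.add_apply, circAbs_val_add]
    refine (circAbs_le_abs (Nat.one_le_iff_ne_zero.mpr (NeZero.ne (N i))) _).trans ?_
    rw [abs_of_nonneg (by positivity)]
    by_cases hi : i = μ
    · subst hi
      rw [unitVec_same, ZMod.val_one_eq_one_mod]
      exact_mod_cast Nat.mod_le 1 _
    · rw [unitVec_ne N hi, ZMod.val_zero]; norm_num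
  exact_mod_cast h

end Torus

section Blocks

variable (n : ℕ) [NeZero n] (M : Fin d → ℕ) [hM : ∀ μ, NeZero (M μ)]

/-- the block `B(y′)` as a finite set of fine sites. [folklore] -/
def blockSet (y' : Tor M) : Finset (Tor (fine n M)) := Finset.univ.filter fun x => blockOf n M x = y'

/-- membership in the block set. [folklore] -/
theorem mem_blockSet {y' : Tor M} {x : Tor (fine n M)} : x ∈ blockSet n M y' ↔ blockOf n M x = y' := by
  simp [blockSet]

/-- block points lie in their block set. [folklore] -/
theorem bpt_mem_blockSet (y' : Tor M) (j : Fin d → Fin n) : bpt n M y' j ∈ blockSet n M y' :=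
  (mem_blockSet n M).mpr (blockOf_bpt n M y' j)

/-- the block set is nonempty. [folklore] -/
theorem blockSet_nonempty (y' : Tor M) : (blockSet n M y').Nonempty :=
  ⟨bpt n M y' fun _ => ⟨0, Nat.pos_of_ne_zero (NeZero.ne n)⟩, bpt_mem_blockSet n M y' _⟩

/-- the chart: every fine site is `bpt (blockOf x) j` for some digit vector `j`. [folklore] -/
theorem exists_eq_bpt_blockOf (x : Tor (fine n M)) : ∃ j : Fin d → Fin n, x = bpt n M (blockOf n M x) j := by
  set e := Equiv.ofBijective _ (bpt_bijective n M) with he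
  refine ⟨(e.symm x).2, ?_⟩
  have hx : x = bpt n M (e.symm x).1 (e.symm x).2 := (e.apply_symm_apply x).symm
  conv_lhs => rw [hx]
  rfl

/-- **unit-vs-fine distance**: for `x = n·y + j ∈ B(y)` and `t = n·y′ + j′ ∈ B(y′)`,
`n·|y − y′|_{T₁} ≤ dist_{T_η}(x, t) + (n − 1)` (per coordinate `n·dist(δ, Mℤ) ≤ dist(nδ + (j − j′), nMℤ) + |j − j′|`, `|j − j′| ≤ n − 1`).
[folklore] -/
theorem mul_ldist_le (y y' : Tor M) (j j' : Fin d → Fin n) :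
    (n : ℝ) * ldist M y y' ≤ ldist (fine n M) (bpt n M y j) (bpt n M y' j') + ((n : ℝ) - 1) := by
  have hn1 : 1 ≤ n := Nat.one_le_iff_ne_zero.mpr (NeZero.ne n)
  have hM1 : ∀ i, 1 ≤ M i := fun i => Nat.one_le_iff_ne_zero.mpr (NeZero.ne (M i))
  have hfine1 : ∀ i, 1 ≤ fine n M i := fun i => Nat.one_le_iff_ne_zero.mpr (NeZero.ne (fine n M i))
  have hR0 : 0 ≤ ldist (fine n M) (bpt n M y j) (bpt n M y' j') := tdist_nonneg _ _ _
  -- per coordinate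
  have hcoord : ∀ i, (n : ℝ) * ((circAbs (M i) ((((y i).val : ℤ)) - ((y' i).val : ℤ)) : ℤ) : ℝ)
      ≤ ldist (fine n M) (bpt n M y j) (bpt n M y' j') + ((n : ℝ) - 1) := by
    intro i
    have hs := circAbs_scale (hM1 i) hn1 (((y i).val : ℤ) - ((y' i).val : ℤ)) (((j i : ℕ) : ℤ) - ((j' i : ℕ) : ℤ))
    have hval : (n : ℤ) * (((y i).val : ℤ) - ((y' i).val : ℤ)) + ((((j i : ℕ) : ℤ)) - ((j' i : ℕ) : ℤ))
        = (((bpt n M y j i).val : ℤ)) - (((bpt n M y' j' i).val : ℤ)) := by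
      rw [bpt_val, bpt_val]; push_cast; ring
    rw [hval] at hs
    have hct : ((circAbs (n * M i) ((((bpt n M y j i).val : ℤ)) - ((bpt n M y' j' i).val : ℤ)) : ℤ) : ℝ)
        ≤ ldist (fine n M) (bpt n M y j) (bpt n M y' j') :=
      circAbs_le_tdist hfine1 (toSite (fine n M) (bpt n M y j)) (toSite (fine n M) (bpt n M y' j')) i
    have hjj : |(((j i : ℕ) : ℤ)) - ((j' i : ℕ) : ℤ)| ≤ (n : ℤ) - 1 := by
      have h1 := (j i).is_lt; have h2 := (j' i).is_lt
      rw [abs_le]; constructor <;> omega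
    have hs' : ((n : ℤ) : ℝ) * ((circAbs (M i) ((((y i).val : ℤ)) - ((y' i).val : ℤ)) : ℤ) : ℝ)
        ≤ ((circAbs (n * M i) ((((bpt n M y j i).val : ℤ)) - ((bpt n M y' j' i).val : ℤ)) : ℤ) : ℝ) + (((n : ℤ) : ℝ) - 1) := by
      have := Int.cast_le (R := ℝ) |>.mpr (hs.trans (add_le_add le_rfl hjj))
      push_cast at this ⊢
      linarith
    push_cast at hs'
    linarith
  -- the sup over coordinates
  by_cases hd : (Finset.univ : Finset (Fin d)).Nonempty
  · obtain ⟨i, -, hi⟩ := Finset.exists_mem_eq_sup (Finset.univ : Finset (Fin d)) hd (ccoord M (toSite M y) (toSite M y'))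
    have hld : ldist M y y' = ((circAbs (M i) ((((y i).val : ℤ)) - ((y' i).val : ℤ)) : ℤ) : ℝ) := by
      show tdist M (toSite M y) (toSite M y') = _
      unfold tdist
      rw [hi]
      have := ccoord_cast hM1 (toSite M y) (toSite M y') i
      exact_mod_cast this
    rw [hld]
    exact hcoord i
  · have hld : ldist M y y' = 0 := by
      show tdist M (toSite M y) (toSite M y') = 0
      unfold tdist
      rw [Finset.not_nonempty_iff_eq_empty.mp hd, Finset.sup_empty, bot_eq_zero, Nat.cast_zero]
    rw [hld, mul_zero]
    have : (1 : ℝ) ≤ n := by exact_mod_cast hn1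
    linarith

end Blocks

/-! ## §2 The distance-to-the-block weight -/

section Weight

variable (n : ℕ) [NeZero n] (M : Fin d → ℕ) [hM : ∀ μ, NeZero (M μ)]

/-- `ρ_T` is `1/n`-Lipschitz along fine bonds — for EVERY torus (the substrate's `rhoS_lipschitz` without its `2 ≤ n·M_μ` proviso).
[folklore] -/
theorem rhoS_lipschitz' (T : Finset (Tor (fine n M))) (hT : T.Nonempty) (x : Tor (fine n M)) (ν : Fin d) :
    |rhoS n M T hT (x + unitVec (fine n M) ν) - rhoS n M T hT x| ≤ 1 / n := by
  have hn0 : (0 : ℝ) < n := by exact_mod_cast Nat.pos_of_ne_zero (NeZero.ne n)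
  rw [rhoS, rhoS, ← mul_sub, abs_mul, abs_of_pos (by positivity : (0 : ℝ) < 1 / n)]
  refine mul_le_of_le_one_right (by positivity) ?_
  have h := abs_distTo_sub_le (ldist (fine n M)) (ldist_symm _) (ldist_triangle _) T hT (x + unitVec (fine n M) ν) x
  exact h.trans (ldist_step_le_one (fine n M) x ν)

/-- the weight to the block `B(y′)`: `ρ_{y′} = n⁻¹·dist_{T_η}(·, B(y′))`. [folklore] -/
abbrev rhoB (y' : Tor M) : Tor (fine n M) → ℝ := rhoS n M (blockSet n M y') (blockSet_nonempty n M y')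

/-- `ρ_{y′} ≤ 0` on `B(y′)`. [folklore] -/
theorem rhoB_le_zero_of_blockOf {y' : Tor M} {x : Tor (fine n M)} (hx : blockOf n M x = y') : rhoB n M y' x ≤ 0 := by
  have hn0 : (0 : ℝ) < n := by exact_mod_cast Nat.pos_of_ne_zero (NeZero.ne n)
  have h := distTo_le_zero_of_mem (ldist (fine n M)) (ldist_self _) (blockSet n M y') (blockSet_nonempty n M y')
    ((mem_blockSet n M).mpr hx)
  exact mul_nonpos_iff.mpr (Or.inl ⟨by positivity, h⟩)

/-- `ρ_{y′} ≥ |y − y′|_{T₁} − 1` on `B(y)`. [folklore] -/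
theorem le_rhoB_of_blockOf {y y' : Tor M} {x : Tor (fine n M)} (hx : blockOf n M x = y) : ldist M y y' - 1 ≤ rhoB n M y' x := by
  have hn0 : (0 : ℝ) < n := by exact_mod_cast Nat.pos_of_ne_zero (NeZero.ne n)
  obtain ⟨j, hxe⟩ := exists_eq_bpt_blockOf n M x
  rw [hx] at hxe
  have hlow : (n : ℝ) * ldist M y y' - ((n : ℝ) - 1) ≤ distTo (ldist (fine n M)) (blockSet n M y') (blockSet_nonempty n M y') x := by
    refine le_distTo _ _ _ fun t ht => ?_
    obtain ⟨j', hte⟩ := exists_eq_bpt_blockOf n M t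
    rw [(mem_blockSet n M).mp ht] at hte
    rw [hxe, hte]
    have := mul_ldist_le n M y y' j j'
    linarith
  have hρ : rhoB n M y' x = 1 / (n : ℝ) * distTo (ldist (fine n M)) (blockSet n M y') (blockSet_nonempty n M y') x := rfl
  rw [hρ]
  have h1 : ldist M y y' - 1 ≤ 1 / (n : ℝ) * ((n : ℝ) * ldist M y y' - ((n : ℝ) - 1)) := by
    rw [show 1 / (n : ℝ) * ((n : ℝ) * ldist M y y' - ((n : ℝ) - 1)) = ldist M y y' - 1 + 1 / n by field_simp; ring]
    have : 0 ≤ 1 / (n : ℝ) := by positivity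
    linarith
  exact h1.trans (mul_le_mul_of_nonneg_left hlow (by positivity))

end Weight

/-! ## §3 The entry of `S` as an `ℓ²` pairing of two block rows -/

section Pairing

variable (n : ℕ) [NeZero n] (M : Fin d → ℕ) [hM : ∀ μ, NeZero (M μ)]

/-- `G′ = (Δ′)⁻¹` (the definition, for rewriting). [folklore] -/
theorem Gps_def (a' : ℝ) : Gps n M a' = (DeltaPs n M a')⁻¹ := rfl

/-- **`S(y,y′) = a′n^d · (Q′ y ⬝ᵥ G′ *ᵥ star (Q′ y′))`**. [folklore] -/
theorem Savg_apply_eq_pairing (a' : ℝ) (y y' : Tor M) :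
    Savg n M a' y y' = ((a' : ℂ) * (n : ℂ) ^ d) * (QsOp n M y ⬝ᵥ (Gps n M a' *ᵥ star (QsOp n M y'))) := by
  rw [Savg_eq, Matrix.smul_apply, smul_eq_mul]
  congr 1
  simp only [Matrix.mul_apply, dotProduct, Matrix.mulVec, Matrix.conjTranspose_apply, Pi.star_apply, Finset.sum_mul,
    Finset.mul_sum]
  rw [Finset.sum_comm]
  refine Finset.sum_congr rfl fun x _ => Finset.sum_congr rfl fun x' _ => ?_
  ring

/-- `‖Q′(y,·)‖₂² = (n^d)⁻¹`. [folklore] -/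
theorem nsq_QsOp_row (y : Tor M) : nsq (fun x => QsOp n M y x) = ((n : ℝ) ^ d)⁻¹ := by
  have hn0 : (0 : ℝ) < n := by exact_mod_cast Nat.pos_of_ne_zero (NeZero.ne n)
  have hnd : (0 : ℝ) < (n : ℝ) ^ d := pow_pos hn0 d
  unfold nsq
  have h1 : ∀ x, ‖QsOp n M y x‖ ^ 2 = if blockOf n M x = y then (((n : ℝ) ^ d)⁻¹) ^ 2 else 0 := by
    intro x
    rw [QsOp_apply_blockOf]
    split_ifs with h
    · rw [norm_div, norm_one, norm_pow, Complex.norm_natCast, one_div]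
    · simp
  simp_rw [h1]
  have h2 : ∑ x : Tor (fine n M), (if blockOf n M x = y then (((n : ℝ) ^ d)⁻¹) ^ 2 else 0)
      = ∑ y₀ : Tor M, ∑ _j : Fin d → Fin n, (if y₀ = y then (((n : ℝ) ^ d)⁻¹) ^ 2 else 0) := by
    have := sum_blocks n M (fun x => ((if blockOf n M x = y then (((n : ℝ) ^ d)⁻¹) ^ 2 else 0 : ℝ) : ℂ))
    simp only [blockOf_bpt] at this
    exact_mod_cast this
  rw [h2, Finset.sum_eq_single y (fun y₀ _ h => by simp [h]) (fun h => absurd (Finset.mem_univ y) h)]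
  simp only [if_true, Finset.sum_const, Finset.card_univ, Fintype.card_pi, Fintype.card_fin, Finset.prod_const, nsmul_eq_mul]
  push_cast
  field_simp

/-- `nsq (star u) = nsq u`. [folklore] -/
theorem nsq_star' (u : Tor (fine n M) → ℂ) : nsq (star u) = nsq u := by
  unfold nsq; simp

end Pairing

/-! ## §4 Entry decay at an admissible rate -/

section Decay

variable (n : ℕ) [NeZero n] (M : Fin d → ℕ) [hM : ∀ μ, NeZero (M μ)]

/-- **ENTRY DECAY OF `S` AT ANY ADMISSIBLE RATE**: for `κ ≥ 0` with `Jfree d a′ κ 1 < γ′`,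
`‖S(y,y′)‖ ≤ a′·e^{κ}/(γ′ − Jfree)·e^{−κ·|y − y′|_{T₁}}`, for every `n ≥ 1` and every torus. [folklore] -/
theorem norm_Savg_apply_le_of_rate {a' κ : ℝ} (ha' : 0 < a') (hκ : 0 ≤ κ) (hJ : Jfree d a' κ 1 < gammaPs d a') (y y' : Tor M) :
    ‖Savg n M a' y y'‖
      ≤ a' * Real.exp κ / (gammaPs d a' - Jfree d a' κ 1) * Real.exp (-(κ * ldist M y y')) := by
  have hn0 : (0 : ℝ) < n := by exact_mod_cast Nat.pos_of_ne_zero (NeZero.ne n)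
  have hnd : (0 : ℝ) < (n : ℝ) ^ d := pow_pos hn0 d
  have hγw : 0 < gammaPs d a' - Jfree d a' κ 1 := sub_pos.mpr hJ
  -- weighted coercivity of Δ′ along the distance-to-B(y′) weight
  have hW : WCoercive (DeltaPs n M a') κ (rhoB n M y') (gammaPs d a' - Jfree d a' κ 1) :=
    wCoercive_DeltaPs n M ha' (rhoS_lipschitz' n M _ _) (rhoS_osc n M _ _)
  -- the pairing bound
  have hpair := hW.pairing_decay_inv hγw hκ (v := star (QsOp n M y')) (u := star (QsOp n M y)) (R := ldist M y y' - 1)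
    (fun e he => by
      have hQ : QsOp n M y e ≠ 0 := fun h => he (by simp [h])
      rw [QsOp_apply_blockOf] at hQ
      have hb : blockOf n M e = y := by by_contra h; exact hQ (if_neg h)
      exact le_rhoB_of_blockOf n M hb)
    (fun e he => by
      have hQ : QsOp n M y' e ≠ 0 := fun h => he (by simp [h])
      rw [QsOp_apply_blockOf] at hQ
      have hb : blockOf n M e = y' := by by_contra h; exact hQ (if_neg h)
      exact rhoB_le_zero_of_blockOf n M hb)
  rw [star_star, ← Gps_def, nsq_star', nsq_star', nsq_QsOp_row, nsq_QsOp_row] at hpair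
  -- assemble
  rw [Savg_apply_eq_pairing, norm_mul]
  have hc : ‖((a' : ℂ) * (n : ℂ) ^ d)‖ = a' * (n : ℝ) ^ d := by
    rw [norm_mul, norm_pow, Complex.norm_real, Complex.norm_natCast, Real.norm_of_nonneg ha'.le]
  rw [hc]
  have hsq : Real.sqrt (((n : ℝ) ^ d)⁻¹) * Real.sqrt (((n : ℝ) ^ d)⁻¹) = ((n : ℝ) ^ d)⁻¹ :=
    Real.mul_self_sqrt (inv_nonneg.mpr hnd.le)
  rw [hsq] at hpair
  calc a' * (n : ℝ) ^ d * ‖QsOp n M y ⬝ᵥ (Gps n M a' *ᵥ star (QsOp n M y'))‖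
      ≤ a' * (n : ℝ) ^ d * (Real.exp (-(κ * (ldist M y y' - 1))) / (gammaPs d a' - Jfree d a' κ 1) * ((n : ℝ) ^ d)⁻¹) :=
        mul_le_mul_of_nonneg_left hpair (by positivity)
    _ = a' * Real.exp κ / (gammaPs d a' - Jfree d a' κ 1) * Real.exp (-(κ * ldist M y y')) := by
        rw [show -(κ * (ldist M y y' - 1)) = κ + -(κ * ldist M y y') by ring, Real.exp_add]
        field_simp

end Decay

/-! ## §5 A rate chosen once for all and the END -/

section End

/-- small rates are admissible with margin `γ′/2`. [folklore] -/
theorem eventually_Jfree_le_half (d : ℕ) (a' : ℝ) :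
    ∀ᶠ κ : ℝ in 𝓝 0, Jfree d a' κ 1 < gammaPs d a' / 2 :=
  ((continuous_Jfree d a' 1).continuousAt (x := (0 : ℝ))).eventually_lt continuousAt_const
    (by rw [Jfree_zero]; exact half_pos (gammaPs_pos (d := d) (a' := a')).1)

/-- the existence statement behind `kappaS`. [folklore] -/
theorem exists_kappaS (d : ℕ) (a' : ℝ) :
    ∃ κ : ℝ, 0 < κ ∧ κ ≤ 1 ∧ Jfree d a' κ 1 < gammaPs d a' / 2 :=
  exists_pos_le_one_of_eventually (eventually_Jfree_le_half d a')

/-- **the decay rate `κ_S(d, a′) ∈ (0, 1]`** of the entries of `S` (an admissible Combes–Thomas rate with margin `γ′/2`, chosen once for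
all from the continuity of `Jfree` at `κ = 0`). [our object] -/
def kappaS (d : ℕ) (a' : ℝ) : ℝ := Classical.choose (exists_kappaS d a')

/-- `κ_S` is positive, `≤ 1`, and admissible with margin. [folklore] -/
theorem kappaS_spec (d : ℕ) (a' : ℝ) :
    0 < kappaS d a' ∧ kappaS d a' ≤ 1 ∧ Jfree d a' (kappaS d a') 1 < gammaPs d a' / 2 :=
  Classical.choose_spec (exists_kappaS d a')

/-- `0 < κ_S`. [folklore] -/
theorem kappaS_pos (d : ℕ) (a' : ℝ) : 0 < kappaS d a' := (kappaS_spec d a').1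

/-- `κ_S ≤ 1`. [folklore] -/
theorem kappaS_le_one (d : ℕ) (a' : ℝ) : kappaS d a' ≤ 1 := (kappaS_spec d a').2.1

/-- **the decay constant `θ_S(d, a′) = 2a′e^{κ_S}/γ′`**. [our object] -/
def thetaS (d : ℕ) (a' : ℝ) : ℝ := 2 * a' * Real.exp (kappaS d a') / gammaPs d a'

/-- `0 < θ_S`. [folklore] -/
theorem thetaS_pos (d : ℕ) {a' : ℝ} (ha' : 0 < a') : 0 < thetaS d a' := by
  have := (gammaPs_pos (d := d) (a' := a')).1
  unfold thetaS; positivity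

variable (n : ℕ) [NeZero n] (M : Fin d → ℕ) [hM : ∀ μ, NeZero (M μ)]

/-- **END — UNIFORM ENTRY DECAY OF `S = a′Q′G′Q′*`**: `‖Savg n M a′ y y′‖ ≤ θ_S(d,a′)·e^{−κ_S(d,a′)·|y − y′|_{T₁}}` for every `n ≥ 1`,
every torus `M`, every pair of unit sites; `|·|_{T₁} = TorusG0Decay.ldist M` (sup circular distance). [folklore] -/
theorem norm_Savg_apply_le {a' : ℝ} (ha' : 0 < a') (y y' : Tor M) :
    ‖Savg n M a' y y'‖ ≤ thetaS d a' * Real.exp (-(kappaS d a' * ldist M y y')) := by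
  obtain ⟨hκ0, -, hJ⟩ := kappaS_spec d a'
  have hγ := (gammaPs_pos (d := d) (a' := a')).1
  have hJ' : Jfree d a' (kappaS d a') 1 < gammaPs d a' := hJ.trans (half_lt_self hγ)
  refine (norm_Savg_apply_le_of_rate n M ha' hκ0.le hJ' y y').trans (mul_le_mul_of_nonneg_right ?_ (Real.exp_pos _).le)
  have hden : gammaPs d a' / 2 ≤ gammaPs d a' - Jfree d a' (kappaS d a') 1 := by linarith
  unfold thetaS
  rw [div_le_div_iff₀ (by linarith) hγ]
  have h0 : 0 ≤ a' * Real.exp (kappaS d a') := by positivity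
  nlinarith

end End

end Summit.QuantumFields.BalabanUV.Beta.GAN24.SavgEntryDecay

end
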